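import Literature.NumberTheory.GaloisRepresentations.HilbertNinetySubgroup
import Literature.NumberTheory.GaloisRepresentations.CohomologicalDimension
import Literature.NumberTheory.GaloisRepresentations.GaloisCohomologyKummerProofs
import Literature.NumberTheory.GaloisRepresentations.AbsGaloisGroup
import Mathlib.FieldTheory.Galois.Infinite
import HarnessLib

/-!
# Base change of the absolute Galois group to a finite subextension: `Γ_E ≃ₜ* Gal(K̄/E) ≤ Γ_K`
# (cell `b2b-bsdres`, team n1011, row T-EPC = Tate's local Euler–Poincaré characteristic; seat p04 GEN 8; stage D5b)

HONEST FRAMING (cell `b2b-bsdres`, run/shared/lean/b2b/bsd-rank1-residual/, verbatim in every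
file): the goal of the cell is to DELETE the COMBINATION-SHAPED residual classes of the
Birch–Swinnerton-Dyer formula for ALL analytic-rank `≤ 1` elliptic curves over `ℚ` — "full BSD
formula for every rank `≤ 1` curve in class `C`" assembled STRICTLY from published theorems — so
that the rank-`≤ 1` remainder becomes exactly the CONSTRUCTION-SHAPED classes, which are TYPED
(missing-input `Prop`s), NOT attempted. This is not "finishing BSD". Team n1011 (N10 / N11, the
additive block X4 ∧ `p = 3`): research route; no claim beyond the stated classes; nothing is
booked; no mark / label is changed by this file. Theorems only (no definition, no named fact, no
`sorry`).  (Placement: Summits/GaloisImage with the T-EPC cone.)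

## What

For a field `K` of characteristic `0` and a subextension `E ⊆ K̄` (`E : IntermediateField K K̄`):

* `EPCBaseChange.exists_continuousMulEquiv_galFixing` — an isomorphism of topological groups
  `ι : Γ_E ≃ₜ* Gal(K̄/E) = galFixing K E` (`Γ_E = Aut_E(Ē)` for the algebraic closure `Ē` of the
  field `E`; `K̄` is another algebraic closure of `E`) such that **if `ι g` fixes `μₙ(K̄)` then `g`
  fixes `μₙ(Ē)`** — the compatibility of the cyclotomic modules `mu K n` and `mu E n` needed to move
  the hypothesis "`Γ_{E'}` acts trivially on `μ_p`" of the tame layer of Tate's theorem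
  (`TameLayer.localEulerPoincare`) from `K` to `E`;
* `EPCBaseChange.mu_apply_eq_self_iff` — `mu K n σ ζ = ζ ↔ σ • ζ = ζ` in `K̄`;
* `EPCBaseChange.isGalois_of_normal_galFixing` — `Gal(K̄/E) ⊴ Γ_K → E/K` Galois (Krull);
* `EPCBaseChange.index_comap_equiv` — indices along `ι`.

References: J.-P. Serre, *Galois Cohomology* (1997), II §1.1 [SerreGaloisCohomology1997];
J. Neukirch, *Algebraic Number Theory* (1999), IV §1 [NeukirchANT1999].
-/

noncomputable section

open Function Field IntermediateField
open Literature.NumberTheory.GaloisRepresentations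
open Literature.NumberTheory.GaloisRepresentations.DiscreteGaloisModule
open Literature.NumberTheory.GaloisRepresentations.LocalWeilDatum

universe u

namespace Summit.BirchSwinnertonDyer.Rank1Residual.GaloisImage

namespace EPCBaseChange

variable (K : Type u) [Field K]

/-- `mu K n σ ζ = ζ` iff `σ` fixes the root of unity `ζ ∈ K̄`. [folklore] -/
theorem mu_apply_eq_self_iff (n : ℕ) (σ : absoluteGaloisGroup K) (ζ : MuCarrier K n) :
    mu K n σ ζ = ζ ↔ σ • ((muVal K n ζ : (AlgebraicClosure K)ˣ) : AlgebraicClosure K) =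
      ((muVal K n ζ : (AlgebraicClosure K)ˣ) : AlgebraicClosure K) := by
  rw [← (muVal_injective K n).eq_iff, muVal_apply, Units.ext_iff, Units.coe_smul]

/-- An element of `K̄` with `x ^ n = 1` (`n ≠ 0`) fixed by every `σ` fixing `μₙ(K̄)`. [folklore] -/
theorem smul_eq_self_of_pow_eq_one {n : ℕ} [NeZero n] {σ : absoluteGaloisGroup K}
    (hσ : ∀ ζ : MuCarrier K n, mu K n σ ζ = ζ) {x : AlgebraicClosure K} (hx : x ^ n = 1) :
    σ • x = x := by
  have h := (mu_apply_eq_self_iff K n σ (MuCarrier.ofRootsOfUnity (rootsOfUnity.mkOfPowEq x hx))).1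
    (hσ _)
  rwa [muVal_ofRootsOfUnity, rootsOfUnity.coe_mkOfPowEq] at h

variable [CharZero K]

/-- **`Γ_E ≃ₜ* Gal(K̄/E)` compatibly with the roots of unity.** For a subextension `E ⊆ K̄` of a
field `K` of characteristic `0` there is an isomorphism of topological groups
`ι : Γ_E ≃ₜ* galFixing K E` (`τ ↦ e⁻¹ ∘ τ ∘ e` restricted to `K`, for an `E`-isomorphism
`e : K̄ ≃ Ē` of algebraic closures of `E`; continuous bijective from a compact group to a
Hausdorff one) such that, for every `n ≠ 0`, if `ι g` fixes every `n`-th root of unity of `K̄`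
then `g` fixes every `n`-th root of unity of `Ē`. [cite: SerreGaloisCohomology1997, II §1.1]
[cite: NeukirchANT1999, IV §1] -/
theorem exists_continuousMulEquiv_galFixing (E : IntermediateField K (AlgebraicClosure K)) :
    ∃ ι : absoluteGaloisGroup E ≃ₜ* galFixing K E, ∀ (n : ℕ) [NeZero n] (g : absoluteGaloisGroup E),
      (∀ ζ : MuCarrier K n, mu K n ((ι g : galFixing K E) : absoluteGaloisGroup K) ζ = ζ) →
        ∀ ζ : MuCarrier E n, mu E n g ζ = ζ := by
  haveI : IsAlgClosure E (AlgebraicClosure K) :=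
    ⟨inferInstance, Algebra.IsAlgebraic.tower_top (K := K) E⟩
  haveI : CharZero E := charZero_of_injective_algebraMap (algebraMap K E).injective
  -- `ψ : Aut_E(K̄) ≃ₜ* Γ_E` and `φ : Aut_E(K̄) →* galFixing K E`
  let e : AlgebraicClosure K ≃ₐ[E] AlgebraicClosure E :=
    IsAlgClosure.equiv E (AlgebraicClosure K) (AlgebraicClosure E)
  let ψ : (AlgebraicClosure K ≃ₐ[E] AlgebraicClosure K) ≃ₜ* absoluteGaloisGroup E :=
    algEquivContinuousMulEquivAbsoluteGaloisGroup E (AlgebraicClosure K)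
  have hψ : ∀ (g : absoluteGaloisGroup E) (x : AlgebraicClosure K), (ψ.symm g) x = e.symm (g • e x) :=
    fun g x => rfl
  let f : absoluteGaloisGroup E →* galFixing K E := (galFixingOfAlgEquiv E).comp ψ.symm.toMonoidHom
  have hf : ∀ g x, ((f g : galFixing K E) : absoluteGaloisGroup K) • x = e.symm (g • e x) := fun g x => by
    rw [← hψ]; exact coe_galFixingOfAlgEquiv_smul E (ψ.symm g) x
  have hfc : Continuous f := (continuous_galFixingOfAlgEquiv E).comp ψ.symm.continuous
  have hfinj : Injective f := by
    intro g g' h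
    apply ψ.symm.injective
    ext x
    have := congrArg (fun t : galFixing K E => (t : absoluteGaloisGroup K) • x) h
    rw [hf, hf] at this
    rw [hψ, hψ, this]
  have hfsurj : Surjective f := fun t => by
    obtain ⟨τ, hτ⟩ := galFixingOfAlgEquiv_surjective E t
    refine ⟨ψ τ, ?_⟩
    change galFixingOfAlgEquiv E (ψ.symm (ψ τ)) = t
    rw [ψ.symm_apply_apply]
    exact hτ
  -- compact to Hausdorff: a homeomorphism
  let e₀ : absoluteGaloisGroup E ≃* galFixing K E := MulEquiv.ofBijective f ⟨hfinj, hfsurj⟩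
  let h₀ : absoluteGaloisGroup E ≃ₜ galFixing K E :=
    Continuous.homeoOfEquivCompactToT2 (f := e₀.toEquiv) hfc
  let ι : absoluteGaloisGroup E ≃ₜ* galFixing K E :=
    { e₀ with
      continuous_toFun := h₀.continuous
      continuous_invFun := h₀.symm.continuous }
  have hι : ∀ g x, ((ι g : galFixing K E) : absoluteGaloisGroup K) • x = e.symm (g • e x) := hf
  refine ⟨ι, fun n _ g hg ζ => ?_⟩
  -- `g` fixes `y = ζ ∈ Ē` because `ι g` fixes `e⁻¹ y ∈ μₙ(K̄)`
  rw [mu_apply_eq_self_iff]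
  set y : AlgebraicClosure E := ((muVal E n ζ : (AlgebraicClosure E)ˣ) : AlgebraicClosure E) with hy
  have hyn : y ^ n = 1 := by
    rw [hy, ← Units.val_pow_eq_pow_val, muVal_pow_eq_one, Units.val_one]
  have hxn : (e.symm y) ^ n = 1 := by rw [← map_pow, hyn, map_one]
  have key := smul_eq_self_of_pow_eq_one K hg hxn
  rw [hι, AlgEquiv.apply_symm_apply] at key
  exact e.symm.injective key

omit [CharZero K] in
/-- `E.fixingSubgroup` is the pull-back of `galFixing K E` along the identity `Aut_K(K̄) = Γ_K`. [folklore] -/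
theorem fixingSubgroup_eq_comap (E : IntermediateField K (AlgebraicClosure K)) :
    E.fixingSubgroup = (galFixing K E).comap (absoluteGaloisGroup.toAlgEquiv K).symm.toMonoidHom := by
  ext σ
  rw [Subgroup.mem_comap, MulEquiv.coe_toMonoidHom, mem_galFixing_iff,
    IntermediateField.mem_fixingSubgroup_iff]
  simp only [absoluteGaloisGroup.toAlgEquiv_symm_apply]

/-- **`Gal(K̄/E) ⊴ Γ_K` implies `E/K` Galois** (fundamental theorem of infinite Galois theory,
Mathlib `InfiniteGalois.normal_iff_isGalois`; `K̄/K` is Galois in characteristic `0`).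
[cite: NeukirchANT1999, IV §1] -/
theorem isGalois_of_normal_galFixing (E : IntermediateField K (AlgebraicClosure K))
    [hN : (galFixing K E).Normal] : IsGalois K E := by
  haveI : E.fixingSubgroup.Normal := by
    rw [fixingSubgroup_eq_comap]
    exact Subgroup.Normal.comap hN _
  exact (InfiniteGalois.normal_iff_isGalois E).1 inferInstance

omit [CharZero K] in
/-- Index transport: for `ι : G ≃* S` onto a subgroup `S ≤ Γ` and `H ≤ Γ`, the pull-back of
`H ∩ S` has index `[S : H ∩ S]`. [folklore] -/
theorem index_comap_equiv {G Γ : Type*} [Group G] [Group Γ] {S : Subgroup Γ} (ι : G ≃* S)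
    (H : Subgroup Γ) : ((H.subgroupOf S).comap ι.toMonoidHom).index = H.relIndex S :=
  Subgroup.index_comap_of_surjective _ ι.surjective

end EPCBaseChange

end Summit.BirchSwinnertonDyer.Rank1Residual.GaloisImage

end
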